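import Mathlib.Topology.MetricSpace.Basic
import Mathlib.Analysis.SpecialFunctions.Exp
import Literature.MathematicalPhysics.QuantumLattice.FinDimSpectrum
import Literature.MathematicalPhysics.QuantumLattice.SpinSystem
import Literature.MathematicalPhysics.QuantumLattice.LatticeTori
import Literature.MathematicalPhysics.QuantumLattice.LocalDynamics
import Literature.MathematicalPhysics.QuantumLattice.MatrixProductStates
import Literature.MathematicalPhysics.QuantumLattice.LTQO
import Literature.Probability.LatticeModels.LatticeGraph
import Literature.Probability.LatticeModels.ThermodynamicLimit
import HarnessLib

-- provenance: harness21/H21/H21/Statements/Hubbard/LiebRobinson.lean @ decbd8b (interim HEAD d8f2665); M5 mechanical rewrite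
/-!
# Lieb–Robinson bounds, exponential clustering, MPS gaps and gap stability (family `hubbard`)

Trunk QLatticeAQFT (G13), family `hubbard`, work item `LatticeDynamicsStatements`. Target
statements about the dynamics and low-energy spectrum of quantum lattice systems with local
interactions, all *known theorems* recorded as NAMED FACTS (`def … : Prop`, D-0014; a discharge
is a `theorem …_holds`):

* **hubbard.S17** `lieb_robinson` — the Lieb–Robinson bound in the multi-site
  Nachtergaele–Ogata–Sims form, uniformly in the finite volume `Λ ⊆ ℤ^d`;
* **hubbard.S18** `hastings_koma` — exponential clustering of gapped ground states
  (Hastings–Koma / Nachtergaele–Sims), uniformly in the box;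
* **hubbard.S16** `fannes_nachtergaele_werner_unique/_gap/_decay` — a normal (injective) matrix
  product state is the unique ground state of its parent Hamiltonian, which is uniformly gapped,
  and has exponentially decaying correlations;
* **hubbard.S19** `michalakis_zwolak` — stability of the spectral gap of frustration-free
  Hamiltonians with local topological quantum order (cluster gap *with* splitting `w L → 0` in
  the conclusion, `L₀` bound; review F6).

Local vocabulary (not in the prelude): `setDist X Y` (the `inf` sup-norm distance of two finite
regions of `ℤ^d`), `inVolume Λ X` (a region `X ⊆ ℤ^d` viewed inside the finite volume `↥Λ`),
`opExpect A ψ = ⟨ψ, A ψ⟩`, `ringDist` (periodic distance on `ℤ/L`), `ringMPS` (the periodic MPS as a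
vector of the ring `ℤ/L`), `torusDiam` (sup-norm diameter of a region of a decorated torus).

## Sources

* E. H. Lieb, D. W. Robinson, *The finite group velocity of quantum spin systems*, CMP **28**
  (1972) 251–257.
* B. Nachtergaele, Y. Ogata, R. Sims, *Propagation of correlations in quantum lattice systems*,
  J. Stat. Phys. **124** (2006) 1–13, Theorem 1 (multi-site LR bound, "NOS06").
  [NachtergaeleOgataSimsJSP2006]
* B. Nachtergaele, R. Sims, *Lieb–Robinson bounds and the exponential clustering theorem*, CMP
  **265** (2006) 119–130, Theorem 1 (LR bound, "NS06"), Theorem 2 (clustering).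
  [NachtergaeleSimsCMP2006]
* M. B. Hastings, T. Koma, *Spectral gap and exponential decay of correlations*, CMP **265** (2006)
  781–804, Thm 8 (bosonic, unique ground state; Thm 6 fermionic) ("HK06"). [HastingsKomaCMP2006]
* M. Fannes, B. Nachtergaele, R. F. Werner, *Finitely correlated states on quantum spin chains*,
  CMP **144** (1992) 443–490 ("FNW92"); B. Nachtergaele, *The spectral gap for some spin chains with
  discrete symmetry breaking*, CMP **175** (1996) 565–606 (uniform gap); D. Perez-Garcia,
  F. Verstraete, M. M. Wolf, J. I. Cirac, Quantum Inf. Comput. **7** (2007) 401, Thms 10–11.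
  [FannesNachtergaeleWernerCMP1992] [NachtergaeleCMP1996]
  [PerezGarciaVerstraeteWolfCiracQIC2007]
* S. Michalakis, J. P. Zwolak, *Stability of frustration-free Hamiltonians*, CMP **322** (2013)
  277–302, Theorem 1 ("MZ13"); S. Bravyi, M. B. Hastings, S. Michalakis, *Topological quantum
  order: stability under local perturbations*, J. Math. Phys. **51** (2010) 093512 ("BHM10").
  [MichalakisZwolakCMP2013] [BravyiHastingsMichalakis2010]

## Mathlib / design notes

* Mathlib search: `Metric.infDist` (point-to-set distance, `HausdorffDistance.lean`) exists, but
  there is no set-to-set `inf` distance (`rg "def (setDist|infDist|infsep)"`: only `Metric.infDist`,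
  `Set.infsep`, `Metric.hausdorffDist`), so `setDist` is defined here as
  `⨅ (x, y) : X × Y, dist x y` (symmetric by construction, `setDist_comm`).
  `Real.exp`, `Finset.subtype`, `dotProduct`, `Matrix.mulVec`, `ZMod.finEquiv` are used;
  `ringDist` is the prelude `torusDist` in dimension one; `opExpect A ψ` has the argument order
  of the Fock-space `Literature.MathematicalPhysics.QuantumLattice.expect` (`Statements/Hubbard/Wave0`).
  Mathlib has no Lieb–Robinson / clustering / MPS / stability vocabulary (`rg -i "lieb.robinson|
  hastings|matrix product"`: nothing).
* All operator norms are the L²-operator norms of `Matrix.Norms.L2Operator` (as in the prelude).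
* `lieb_robinson`, `hastings_koma`: the constants `C, μ, v` (resp. `C, ξ`) are quantified *before*
  the volume, which is how "uniformly in `Λ`" is expressed. In `hastings_koma` we keep a
  `min (|X|, |Y|)` prefactor: NS06 Thm 2 as printed takes `A ∈ 𝔄_x` single-site and `B ∈ 𝔄_Y`
  with `c(A, B) = ‖A‖ ‖B‖ (1 + 2|Y|/π + 1/√(πμ d(x,Y)))`; the `min` form for `A ∈ 𝔄_X` is the
  standard corollary obtained by running the NS06 Thm 2 proof with the multi-site Lieb–Robinson
  bound of NOS06 Thm 1 in place of the single-site one (HK06 Thm 8 with `P₀ = |Ω⟩⟨Ω|` gives the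
  same decay); the inventory text absorbs the prefactor into `C`.
* `fannes_nachtergaele_werner_*`: `parentHamiltonian L ℓ A` (prelude Q9) lives on the ring `ZMod L`
  and is meaningful for `ℓ ≤ L`; the statements assume `2ℓ ≤ L` as in FNW92 / PVWC07 Thm 10. The
  MPS tensor is *not* assumed normalised: uniqueness and the ground-state property are algebraic,
  and normalised correlations are invariant under `A ↦ c • A`. All three assume `[NeZero D]`
  (positive bond dimension): for `D = 0` every tensor is vacuously normal while `ringMPS L A = 0`
  and `parentHamiltonian L ℓ A = L • 1`, so uniqueness and the gap would be false (see the
  docstring of `IsNormalMPS`).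
* `michalakis_zwolak`: decorated tori `TorusSite d L × κ` (outline Q-D6); every quantifier over the
  side `L` carries `[NeZero L]` (needed for `Fintype (ZMod L)`), exactly as in `HasUniformLTQO`.
* Junk values: `setDist X Y = 0` if `X = ∅` or `Y = ∅` (`iInf` over an empty type in `ℝ`);
  `torusDiam ∅ = 0` (`Finset.sup` into `ℕ`, bottom `0`); the normalised correlation in `fannes_nachtergaele_werner_decay` is `0` for the zero vector
  (`x / 0 = 0`), which the hypothesis `L₀ ≤ L` is there to exclude.
-/

noncomputable section

open Matrix Complex Finset
open scoped Matrix.Norms.L2Operator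

namespace Literature.MathematicalPhysics.QuantumLattice

open Literature.Probability.LatticeModels

/-! ### Local vocabulary -/

section Vocabulary

variable {d : ℕ}

/-- The distance `d(X, Y) = min_{x ∈ X, y ∈ Y} |x - y|_∞` between two finite regions of `ℤ^d`
(sup-norm metric of `Site d = Fin d → ℤ`), as the infimum of `dist x y` over the pairs
`(x, y) ∈ X × Y`. **Junk value** `0` when `X` or `Y` is empty (`iInf` over an empty type in `ℝ`).
Mathlib has the point-to-set `Metric.infDist` but no set-to-set version. NS06 §2 ("`d(X,Y)`");
HK06 §2. [folklore] -/
def setDist (X Y : Finset (Site d)) : ℝ :=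
  ⨅ p : ↥X × ↥Y, dist (p.1 : Site d) (p.2 : Site d)

/-- `setDist` is nonnegative. NS06 §2. [folklore] -/
theorem setDist_nonneg (X Y : Finset (Site d)) : 0 ≤ setDist X Y :=
  Real.iInf_nonneg fun _ => dist_nonneg

/-- `setDist` is bounded by the distance of any pair of points. NS06 §2. [folklore] -/
theorem setDist_le_dist {X Y : Finset (Site d)} {x y : Site d} (hx : x ∈ X) (hy : y ∈ Y) :
    setDist X Y ≤ dist x y :=
  ciInf_le ⟨0, Set.forall_mem_range.2 fun _ => dist_nonneg⟩ ((⟨x, hx⟩, ⟨y, hy⟩) : ↥X × ↥Y)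

/-- `setDist` is symmetric. NS06 §2. [folklore] -/
theorem setDist_comm (X Y : Finset (Site d)) : setDist X Y = setDist Y X := by
  unfold setDist
  rw [← (Equiv.prodComm ↥Y ↥X).iInf_comp]
  exact iInf_congr fun p => dist_comm _ _

/-- A region `X ⊆ ℤ^d` viewed inside the finite volume `Λ`: the finite set `X ∩ Λ` as a `Finset`
of the subtype `↥Λ` (Mathlib's `Finset.subtype`). NS06 §2 (`X ⊂ Λ`). [folklore] -/
def inVolume (Λ X : Finset (Site d)) : Finset ↥Λ :=
  X.subtype (· ∈ Λ)

/-- Membership in `inVolume Λ X`. NS06 §2. [folklore] -/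
@[simp] theorem mem_inVolume {Λ X : Finset (Site d)} {x : ↥Λ} :
    x ∈ inVolume Λ X ↔ (x : Site d) ∈ X := by
  simp [inVolume]

/-- The expectation value `⟨ψ, A ψ⟩ = star ψ ⬝ᵥ (A *ᵥ ψ)` of a matrix in a vector (generic
index type; same shape and argument order as the Fock-space `Literature.MathematicalPhysics.QuantumLattice.expect` of
`Statements/Hubbard/Wave0`, which is specialised to `Matrix (Finset ι) (Finset ι) ℂ`).
HK06 §1; NS06 §3. [folklore] -/
def opExpect {n : Type*} [Fintype n] (A : Matrix n n ℂ) (ψ : n → ℂ) : ℂ :=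
  star ψ ⬝ᵥ (A *ᵥ ψ)

/-- The periodic distance `min ((x - y) mod L, L - (x - y) mod L)` on the ring `ℤ/L`: the `d = 1`
case of the prelude's sup-norm torus distance `Literature.MathematicalPhysics.QuantumLattice.torusDist` (applied to the constant
maps `Fin 1 → ZMod L`). FNW92 §2. [folklore] -/
def ringDist {L : ℕ} (x y : ZMod L) : ℕ :=
  torusDist (Ls := fun _ : Fin 1 => L) (fun _ => x) (fun _ => y)

/-- The translation-invariant periodic MPS `ψ(σ) = tr (A^{σ₀} ⋯ A^{σ_{L-1}})` as a vector of the
spin ring `ℤ/L` (`mpsPeriodic` pulled back along `ZMod.finEquiv`, as in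
`parentHamiltonian_mulVec_mps_eq_zero`). FNW92 §2. [folklore] -/
def ringMPS {q D : ℕ} (L : ℕ) [NeZero L] (A : MPSTensor q D) : TensorIndex (ZMod L) q → ℂ :=
  fun σ => mpsPeriodic L A (σ ∘ ZMod.finEquiv L)

/-- The sup-norm diameter `max_{x, y ∈ X} torusDist x y` of a region of the decorated torus
`(ℤ/Lℤ)^d × κ` (distance of the underlying Bravais sites). **Junk value** `0` for `X = ∅`
(`Finset.sup` into `ℕ`). MZ13 §2. [folklore] -/
def torusDiam {L : ℕ} {κ : Type*} (X : Finset (TorusSite d L × κ)) : ℕ :=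
  X.sup fun x => X.sup fun y => torusDist x.1 y.1

end Vocabulary

/-! ### hubbard.S17: the Lieb–Robinson bound -/

section LiebRobinson

variable (d q : ℕ)

/-- **hubbard.S17** (Lieb–Robinson bound, multi-site `min(|X|, |Y|)` form: Nachtergaele–Ogata–Sims,
J. Stat. Phys. **124** (2006) 1, Thm 1 — the double sum `∑_{x∈X} ∑_{y∈Y} F(d(x,y))` bounded by
`min(|X|, |Y|) ‖F‖ e^{-a d(X,Y)}`; the single-site form (`A ∈ 𝔄_x`, prefactor `2|Y|`) is
Nachtergaele–Sims, CMP **265** (2006) 119, Thm 1; originally Lieb–Robinson, CMP **28** (1972) 251;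
cf. Hastings–Koma, CMP **265** (2006) 781, Thm 17 with `|X| |Y|`). Let `Φ` be a Hermitian
interaction on `ℤ^d` of finite range `R` with `‖Φ X‖ ≤ J`.
There are constants `C`, `μ > 0`, `v > 0` (depending only on `d, q, R, J`) such that for every
finite volume `Λ ⊆ ℤ^d`, regions `X, Y ⊆ Λ`, observables `A ∈ 𝔄_X`, `B ∈ 𝔄_Y` and all times `t`,
`‖[τ_t^Λ(A), B]‖ ≤ C ‖A‖ ‖B‖ min(|X|, |Y|) e^{-μ (d(X,Y) - v|t|)}`, where
`τ_t^Λ = heisenbergEvolution (H_Λ)` is generated by `H_Λ = Σ_{Z ⊆ Λ} Φ Z`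
(`localHamiltonian (Φ.restrict Λ) univ`) and `d(X, Y) = setDist X Y`.
The printed NS06 Thm 1 is the single-site bound (`A ∈ 𝔄_x`, prefactor `2|Y|`); the
`min(|X|, |Y|)` multi-site form stated here is Nachtergaele–Ogata–Sims 2006, Thm 1 (cf. HK06
Thm 17 with `|X| |Y|`). [cite: NachtergaeleOgataSimsJSP2006, Thm. 1] -/
def lieb_robinson : Prop :=
  ∀ (Φ : LatticeInteraction d q) {R J : ℝ} (hH : Φ.IsHermitian) (hR : Φ.HasFiniteRange R) (hJ : Φ.IsBounded J),
    ∃ C μ v : ℝ, 0 < μ ∧ 0 < v ∧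
      ∀ (Λ X Y : Finset (Site d)), X ⊆ Λ → Y ⊆ Λ →
        ∀ (A B : Op ↥Λ q), IsSupportedOn A (inVolume Λ X) → IsSupportedOn B (inVolume Λ Y) →
          ∀ t : ℝ,
            ‖heisenbergEvolution (localHamiltonian (Φ.restrict Λ) univ) t A * B -
                B * heisenbergEvolution (localHamiltonian (Φ.restrict Λ) univ) t A‖ ≤
              C * ‖A‖ * ‖B‖ * (min X.card Y.card : ℕ) *
                Real.exp (-μ * (setDist X Y - v * |t|))

end LiebRobinson

/-! ### hubbard.S18: exponential clustering (Hastings–Koma / Nachtergaele–Sims) -/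

section Clustering

variable (d q : ℕ)

/-- **hubbard.S18** (exponential clustering from a uniform gap; Hastings–Koma, CMP **265** (2006)
781, Thm 8 (unique ground state, `P₀ = |Ω⟩⟨Ω|`); Nachtergaele–Sims, CMP **265** (2006) 119,
Thm 2). Let `Φ` be a Hermitian
finite-range bounded interaction on `ℤ^d` whose box Hamiltonians `H_L = boxHamiltonian Φ L` on
`Λ_L = {-L, …, L}^d` have a unique ground state with a spectral gap `≥ γ > 0` uniformly in `L`.
Then there are `C` and a correlation length `ξ > 0`, independent of `L`, such that for every
normalised ground-state vector `ψ_L` of `H_L` and observables `A ∈ 𝔄_X`, `B ∈ 𝔄_Y`,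
`X, Y ⊆ Λ_L`: `|⟨ψ_L, A B ψ_L⟩ - ⟨ψ_L, A ψ_L⟩ ⟨ψ_L, B ψ_L⟩| ≤ C ‖A‖ ‖B‖ min(|X|, |Y|) e^{-d(X,Y)/ξ}`
(the `min(|X|, |Y|)` form is the corollary of the NS06 Thm 2 proof run with the multi-site
Lieb–Robinson bound of NOS06 Thm 1; HK06 Thm 8 with `P₀ = |Ω⟩⟨Ω|` gives the same decay; see the
module docstring).
[cite: HastingsKomaCMP2006, Thm. 8; corollary form of NachtergaeleSimsCMP2006 Thm. 2] -/
def hastings_koma : Prop :=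
  ∀ (Φ : LatticeInteraction d q) {R J : ℝ} (hH : Φ.IsHermitian) (hR : Φ.HasFiniteRange R) (hJ : Φ.IsBounded J) (hgap : ∃ γ > 0, ∀ L : ℕ, (boxHamiltonian Φ L).HasSpectralGap γ),
    ∃ C ξ : ℝ, 0 < ξ ∧
      ∀ (L : ℕ) (X Y : Finset (Site d)), X ⊆ box d L → Y ⊆ box d L →
        ∀ (A B : Op ↥(box d L) q) (ψ : TensorIndex ↥(box d L) q → ℂ),
          (boxHamiltonian Φ L).IsGroundStateVector ψ → star ψ ⬝ᵥ ψ = 1 →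
          IsSupportedOn A (inVolume (box d L) X) → IsSupportedOn B (inVolume (box d L) Y) →
            ‖opExpect (A * B) ψ - opExpect A ψ * opExpect B ψ‖ ≤
              C * ‖A‖ * ‖B‖ * (min X.card Y.card : ℕ) * Real.exp (-setDist X Y / ξ)

end Clustering

/-! ### hubbard.S16: Fannes–Nachtergaele–Werner -/

section FNW

variable {q D : ℕ}

/-- **hubbard.S16** (Fannes–Nachtergaele–Werner, uniqueness and ground-state property; FNW,
CMP **144** (1992) 443, Thm 5.7 (infinite chain); the periodic-ring form is
Perez-Garcia–Verstraete–Wolf–Cirac, QIC **7** (2007) 401, Thm 10).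
For a normal (injective) MPS tensor `A` of positive bond dimension `D` (`[NeZero D]`, see the
module docstring) there is a block length `ℓ₀` such that for every `ℓ ≥ ℓ₀`
and every ring `ℤ/L` with `L ≥ 2ℓ`, the parent Hamiltonian `H = Σ_x h_{x,…,x+ℓ-1}`
(`parentHamiltonian L ℓ A`) has a unique ground state, and the periodic MPS `ringMPS L A` is a
ground-state vector (of energy `0`).
[cite: PerezGarciaVerstraeteWolfCiracQIC2007, Thm. 10 (ring form); FNW CMP 1992 Thm. 5.7] -/
def fannes_nachtergaele_werner_unique : Prop :=
  ∀ [NeZero D] (A : MPSTensor q D) (hA : IsNormalMPS A),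
    ∃ ℓ₀ : ℕ, ∀ ℓ : ℕ, ℓ₀ ≤ ℓ → ∀ (L : ℕ) [NeZero L], 2 * ℓ ≤ L →
      (parentHamiltonian L ℓ A).HasUniqueGroundState ∧
        (parentHamiltonian L ℓ A).IsGroundStateVector (ringMPS L A)

/-- **hubbard.S16** (Fannes–Nachtergaele–Werner, uniform spectral gap; FNW, CMP **144** (1992)
443, Thm 6.4 with Lemma 6.1 (gap inequality (6.4) for the infinite-volume state, linked to the
first non-zero eigenvalue of the open chains `H_{[1,n]}`); periodic-ring uniform form:
Perez-Garcia–Verstraete–Wolf–Cirac, QIC **7** (2007) 401, §4.2; see also Nachtergaele, CMP **175**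
(1996) 565, the gap theorem of §1). For a normal MPS tensor `A` of
positive bond dimension `D` there is
`ℓ₀` such that for every block length `ℓ ≥ ℓ₀` the parent Hamiltonians `parentHamiltonian L ℓ A`
have a spectral gap `γ > 0` above their unique ground state, *uniformly* in the ring size
`L ≥ 2ℓ`.
[cite: FannesNachtergaeleWernerCMP1992, Thm. 6.4 with Lemma 6.1; ring form PVWC QIC 2007 §4.2] -/
def fannes_nachtergaele_werner_gap : Prop :=
  ∀ [NeZero D] (A : MPSTensor q D) (hA : IsNormalMPS A),
    ∃ ℓ₀ : ℕ, ∀ ℓ : ℕ, ℓ₀ ≤ ℓ → ∃ γ > 0, ∀ (L : ℕ) [NeZero L], 2 * ℓ ≤ L →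
      (parentHamiltonian L ℓ A).HasSpectralGap γ

/-- **hubbard.S16** (Fannes–Nachtergaele–Werner, exponential decay of correlations; FNW, CMP
**144** (1992) 443, §3, Prop. 3.1 ((3) ⇒ (2): clustering of a finitely correlated state when `1`
is the only peripheral eigenvalue of the transfer operator `E` — an infinite-chain statement; the
periodic-ring, uniform-in-`L` form below is its corollary through the transfer-matrix expression
of ring correlations, Perez-Garcia–Verstraete–Wolf–Cirac, QIC **7** (2007) 401, §3.2). For a normal
MPS tensor `A` (bond dimension `D > 0`) the
periodic MPS
`ψ_L = ringMPS L A` has exponentially clustering correlations, uniformly in the ring size: there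
are `C`, `ξ > 0` and `L₀` such that for all `L ≥ L₀`, sites `x, y ∈ ℤ/L` and single-site
observables `a, b`,
`|⟨a_x b_y⟩ - ⟨a_x⟩ ⟨b_y⟩| ≤ C ‖a‖ ‖b‖ e^{-ringDist x y / ξ}`, where
`⟨O⟩ = ⟨ψ_L, O ψ_L⟩ / ⟨ψ_L, ψ_L⟩` and `a_x = onSite x a`. (For `L ≥ L₀` the vector `ψ_L` is
nonzero; the normalised expectation has the junk value `0` otherwise.)
[cite: FannesNachtergaeleWernerCMP1992, §3 Prop. 3.1; ring form via PVWC QIC 2007 §3.2] -/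
def fannes_nachtergaele_werner_decay : Prop :=
  ∀ [NeZero D] (A : MPSTensor q D) (hA : IsNormalMPS A),
    ∃ C ξ : ℝ, 0 < ξ ∧ ∃ L₀ : ℕ, ∀ (L : ℕ) [NeZero L], L₀ ≤ L →
      ∀ (x y : ZMod L) (a b : Matrix (Fin q) (Fin q) ℂ),
        ‖opExpect (onSite x a * onSite y b) (ringMPS L A) / opExpect 1 (ringMPS L A) -
            opExpect (onSite x a) (ringMPS L A) / opExpect 1 (ringMPS L A) *
              (opExpect (onSite y b) (ringMPS L A) / opExpect 1 (ringMPS L A))‖ ≤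
          C * ‖a‖ * ‖b‖ * Real.exp (-(ringDist x y : ℝ) / ξ)

end FNW

/-! ### hubbard.S19: stability of frustration-free gapped Hamiltonians (Michalakis–Zwolak) -/

section Stability

variable (d q : ℕ) {κ : Type*} [Fintype κ] [DecidableEq κ]

/-- **hubbard.S19** (stability of the spectral gap under local perturbations; Michalakis–Zwolak,
CMP **322** (2013) 277, Theorem 1; Bravyi–Hastings–Michalakis, J. Math. Phys. **51** (2010)
093512, Theorem 1; Nachtergaele–Sims–Young, AHP **23** (2022) 393). Let `Φ L` be a family of
frustration-free, local projector interactions of uniform finite range `r₀` on the decorated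
tori `(ℤ/Lℤ)^d × κ`, whose Hamiltonians `H₀(L) = Σ_X Φ L X` have an exactly `m L`-fold degenerate
ground space with a uniform gap `γ > 0` (`HasClusterGap _ (m L) 0 γ`), satisfying local
topological quantum order with a superpolynomially decaying rate `Δ` (`HasUniformLTQO`,
`HasFastDecay`) and the local-gap condition with a rate `γloc` decaying at most polynomially
(`HasUniformLocalGap`). Then for every perturbation range `r` and every family of local
perturbations `V L` with terms of range `≤ r` and norm `≤ 1` there are `ε₀ > 0`, `L₀` and a
*decaying* splitting function `w` (MZ13 Thm 1 gives it explicitly: the ground cluster of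
`H₀ + εV` has width bounded by a polynomial in `L` times the LTQO rate `Δ` and the local-gap /
Lieb–Robinson tails evaluated at a fractional power of `L`, which tends to `0` by fast decay of
`Δ`) such that for `|ε| < ε₀` and `L ≥ L₀` the perturbed Hamiltonian `H₀(L) + ε V(L)` has a
cluster of `m L` low-lying eigenvalues of width `≤ w L` separated from the rest of the spectrum by
a gap `≥ γ/2` (`HasClusterGap _ (m L) (w L) (γ/2)`; review F6: the splitting is part of the
conclusion). [cite: MichalakisZwolakCMP2013, Thm. 1] -/
def michalakis_zwolak : Prop :=
  ∀ (Φ : (L : ℕ) → Interaction (TorusSite d L × κ) q) (m : ℕ → ℕ) (γ : ℝ) (r₀ : ℕ) (Δ γloc : ℕ → ℝ) (hproj : ∀ (L : ℕ) [NeZero L], IsProjectorInteraction (Φ L) ∧ (Φ L).IsLocal) (hff : ∀ (L : ℕ) [NeZero L], IsFrustrationFree (Φ L) univ) (hrange : ∀ (L : ℕ) [NeZero L] (X : Finset (TorusSite d L × κ)), r₀ < torusDiam X → Φ L X = 0) (hgap : 0 < γ ∧ ∀ (L : ℕ) [NeZero L], (localHamiltonian (Φ L) univ).HasClusterGap (m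 L) 0 γ) (hltqo : HasUniformLTQO Φ Δ) (hΔ : HasFastDecay Δ) (hloc : HasUniformLocalGap Φ γloc) (hγloc : ∃ c : ℝ, ∃ p : ℕ, 0 < c ∧ ∀ ℓ : ℕ, c / ((ℓ : ℝ) + 1) ^ p ≤ γloc ℓ),
    ∀ (r : ℕ) (V : (L : ℕ) → Interaction (TorusSite d L × κ) q),
      (∀ (L : ℕ) [NeZero L], (V L).IsLocal ∧
        (∀ X, r < torusDiam X → V L X = 0) ∧ ∀ X, ‖V L X‖ ≤ 1) →
      ∃ ε₀ > 0, ∃ L₀ : ℕ, ∃ w : ℕ → ℝ, IsDecaying w ∧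
        ∀ ε : ℝ, |ε| < ε₀ → ∀ (L : ℕ) [NeZero L], L₀ ≤ L →
          (localHamiltonian (Φ L) univ + (ε : ℂ) • localHamiltonian (V L) univ).HasClusterGap
            (m L) (w L) (γ / 2)

end Stability

end Literature.MathematicalPhysics.QuantumLattice
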